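import Mathlib.MeasureTheory.Integral.Bochner.Set
import Mathlib.MeasureTheory.Measure.Real
import Mathlib.Analysis.SpecificLimits.Basic
import HarnessLib

/-!
# Kozma–Nitzan §4, Lemma 10, Step II — the level-counting argument, ABSTRACT over the probability space
# (model-free form of `L/KozmaNitzanTargetLemma.lean` ll. 795–1270, written once for the SITE re-typing)

builds on p205010 (kernel theorem, internal audit signed; external expert review pending).
Lane `prim-bschramm`, class C1a (site percolation on `ℤ³`), seat p1 gen 3, block (α) of the SITE same-`p` witness
(`SiteSameP.SiteSamePWitnessZd`, socket p217536).  Helper file (`--supports stmt-CriticalPhenomena-4575`).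

Step II of the proof of KN's Lemma 10 (arXiv:2401.12397, §4 p. 18) is a counting argument about two families of events
indexed by the levels `j`: `F j` ("fewer than `N` contact vertices at level `j`", `¬E_j`) and `D j` ("an open contact at
level `j`", the events behind `G_i` of (18)).  It uses only: (i) a ONE-LEVEL ESTIMATE `P(H_{t,j} ∩ D_j) ≤ r·P(H_{t,j})`
for the events `H_{t,j}` = "`j` is the `(t+1)`-st outermost failure level and the `t` failure levels above it carry open
contacts" (in the models: independence of the fresh contacts from the configuration outside `B⟨j⟩`); (ii) that the
good event `C` (`{o ↔ B}`) forces `D j` at every level, almost surely.  This file proves the argument for an arbitrary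
probability space, so that the bond proof (in the tree) and the site proof (block (α)) share it:

* `failAbove`, `Hev`, `Aev` and their combinatorics (`failAbove_min'`, `Hev_subset_Aev`, `Hev_disjoint`);
* `real_Aev_le` — `P(A_t) ≤ r^t` from the one-level estimate ((17)–(18));
* `inter_subset_Aev` — on `C ∩ G` (`G ⊆ D j` for all `j`), `t` failure levels give `A_t`;
* `sum_real_inter_eq` — `Σ_j P(C ∩ F_j) = Σ_{t=1}^{|J|} P(C ∩ {t ≤ #failure levels})` (both are `E[#failures; C]`);
* **`stepII_abstract`** — if `P(C) > 1 − δ`, `|J| ≥ q⁻¹/δ` with `r = 1 − q`, then at some level `j ∈ J`,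
  `P(F_jᶜ) > 1 − 2δ`.
[cite: KozmaNitzan2024, §4 p. 18 (Step II, (17)–(18))]
-/

noncomputable section

namespace Summit.CriticalPhenomena.PercolationContinuityZ3.Theorems.Transplant

namespace SiteKN

namespace FailLevels

open MeasureTheory

variable {Ω : Type*}

/-! ## The events -/

open Classical in
/-- The failure levels of `J` strictly above `j`. [cite: KozmaNitzan2024, §4 p. 18 (the levels j_i)] -/
def failAbove (F : ℕ → Set Ω) (J : Finset ℕ) (j : ℕ) (ω : Ω) : Finset ℕ :=
  J.filter fun j' => j < j' ∧ ω ∈ F j'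

/-- `H_{t,j}`: level `j` is the `(t+1)`-st outermost failure level of `J`, and at the `t` failure levels above it the
event `D` occurs. [cite: KozmaNitzan2024, §4 p. 18 (the events G_i)] -/
def Hev (F D : ℕ → Set Ω) (J : Finset ℕ) (t j : ℕ) : Set Ω :=
  {ω | ω ∈ F j ∧ (failAbove F J j ω).card = t ∧ ∀ j' ∈ J, j < j' → ω ∈ F j' → ω ∈ D j'}

/-- `A_t`: the `t` outermost failure levels of `J` exist and at each of them `D` occurs (`G_1 ∩ ⋯ ∩ G_t` of (18)).
[cite: KozmaNitzan2024, §4 p. 18 ((17)–(18))] -/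
def Aev (F D : ℕ → Set Ω) (J : Finset ℕ) : ℕ → Set Ω
  | 0 => Set.univ
  | t + 1 => ⋃ j ∈ J, (Hev F D J t j ∩ D j)

variable {F D : ℕ → Set Ω} {J : Finset ℕ}

/-- Membership in `failAbove`. [folklore] -/
theorem mem_failAbove_iff {j j' : ℕ} {ω : Ω} : j' ∈ failAbove F J j ω ↔ j' ∈ J ∧ j < j' ∧ ω ∈ F j' := by
  classical
  rw [failAbove, Finset.mem_filter]

/-- Passing to the lowest failure level above `j` removes exactly that level from the failure levels above. [folklore] -/
theorem failAbove_min' {j : ℕ} {ω : Ω} (hne : (failAbove F J j ω).Nonempty) :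
    failAbove F J ((failAbove F J j ω).min' hne) ω = (failAbove F J j ω).erase ((failAbove F J j ω).min' hne) := by
  classical
  set s := failAbove F J j ω with hs
  set m := s.min' hne with hm
  have hm_mem : m ∈ s := Finset.min'_mem s hne
  ext j''
  rw [Finset.mem_erase, mem_failAbove_iff, mem_failAbove_iff]
  have hjm : j < m := (mem_failAbove_iff.1 (hs ▸ hm_mem)).2.1
  constructor
  · rintro ⟨hJ, hmj, hF⟩
    exact ⟨ne_of_gt hmj, hJ, hjm.trans hmj, hF⟩
  · rintro ⟨hne', hJ, hjj, hF⟩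
    refine ⟨hJ, lt_of_le_of_ne (Finset.min'_le s j'' ?_) (Ne.symm hne'), hF⟩
    rw [hs, mem_failAbove_iff]; exact ⟨hJ, hjj, hF⟩

/-- `H_{t,j} ⊆ A_t`. [folklore] -/
theorem Hev_subset_Aev (t j : ℕ) : Hev F D J t j ⊆ Aev F D J t := by
  classical
  cases t with
  | zero => intro ω _; exact Set.mem_univ ω
  | succ t =>
    rintro ω ⟨-, hcard, hD⟩
    have hne : (failAbove F J j ω).Nonempty := by
      rw [← Finset.card_pos, hcard]; exact Nat.succ_pos t
    set m := (failAbove F J j ω).min' hne with hm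
    have hm_mem := Finset.min'_mem _ hne
    rw [← hm] at hm_mem
    obtain ⟨hmJ, hjm, hmF⟩ := mem_failAbove_iff.1 hm_mem
    simp only [Aev, Set.mem_iUnion, exists_prop]
    refine ⟨m, hmJ, ⟨hmF, ?_, fun j' hj' hmj' hF' => hD j' hj' (hjm.trans hmj') hF'⟩, hD m hmJ hjm hmF⟩
    rw [hm, failAbove_min' hne, Finset.card_erase_of_mem (hm ▸ hm_mem), hcard]
    rfl

/-- The events `H_{t,j}`, `j ∈ J`, are pairwise disjoint. [folklore] -/
theorem Hev_disjoint (t : ℕ) {j j' : ℕ} (hjj' : j ≠ j') (hj' : j' ∈ J) (hj : j ∈ J) :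
    Disjoint (Hev F D J t j) (Hev F D J t j') := by
  classical
  wlog hlt : j < j' generalizing j j'
  · exact (this hjj'.symm hj hj' (lt_of_le_of_ne (not_lt.1 hlt) hjj'.symm)).symm
  rw [Set.disjoint_left]
  rintro ω ⟨hF, hcard, -⟩ ⟨hF', hcard', -⟩
  have hmem : j' ∈ failAbove F J j ω := mem_failAbove_iff.2 ⟨hj', hlt, hF'⟩
  have hsub : failAbove F J j' ω ⊆ (failAbove F J j ω).erase j' := by
    intro j'' hj''
    obtain ⟨hJ, hlt', hF''⟩ := mem_failAbove_iff.1 hj''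
    exact Finset.mem_erase.2 ⟨ne_of_gt hlt', mem_failAbove_iff.2 ⟨hJ, hlt.trans hlt', hF''⟩⟩
  have h1 : 0 < (failAbove F J j ω).card := Finset.card_pos.2 ⟨_, hmem⟩
  have h2 := Finset.card_le_card hsub
  rw [Finset.card_erase_of_mem hmem] at h2
  rw [hcard] at h1 h2
  rw [hcard'] at h2
  omega

/-! ## The probabilistic estimates -/

variable [MeasurableSpace Ω]

/-- **`P(A_t) ≤ r^t`** from the one-level estimate `P(H_{t,j} ∩ D_j) ≤ r·P(H_{t,j})`, `j ∈ J` (eq. (17)–(18)).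
[cite: KozmaNitzan2024, §4 p. 18 ((17)–(18))] -/
theorem real_Aev_le (μ : Measure Ω) [IsProbabilityMeasure μ] {r : ℝ} (hr0 : 0 ≤ r)
    (hHm : ∀ t j, MeasurableSet (Hev F D J t j))
    (hone : ∀ t, ∀ j ∈ J, μ.real (Hev F D J t j ∩ D j) ≤ r * μ.real (Hev F D J t j)) (t : ℕ) :
    μ.real (Aev F D J t) ≤ r ^ t := by
  classical
  induction t with
  | zero => rw [pow_zero]; exact measureReal_le_one
  | succ t ih =>
    calc μ.real (Aev F D J (t + 1)) ≤ ∑ j ∈ J, μ.real (Hev F D J t j ∩ D j) := by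
          simp only [Aev]; exact measureReal_biUnion_finset_le (μ := μ) J _
      _ ≤ ∑ j ∈ J, r * μ.real (Hev F D J t j) := Finset.sum_le_sum fun j hj => hone t j hj
      _ = r * μ.real (⋃ j ∈ J, Hev F D J t j) := by
          rw [← Finset.mul_sum, measureReal_biUnion_finset (fun j hj j' hj' hne =>
            Hev_disjoint t hne (Finset.mem_coe.1 hj') (Finset.mem_coe.1 hj)) (fun j _ => hHm t j)]
      _ ≤ r * μ.real (Aev F D J t) := by
          refine mul_le_mul_of_nonneg_left (measureReal_mono ?_) hr0
          exact Set.iUnion₂_subset fun j _ => Hev_subset_Aev t j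
      _ ≤ r * r ^ t := mul_le_mul_of_nonneg_left ih hr0
      _ = r ^ (t + 1) := by ring

omit [MeasurableSpace Ω] in
open Classical in
/-- **On an event forcing `D` at every level, `t` failure levels in `J` give `A_t`.**
[cite: KozmaNitzan2024, §4 p. 18 ("X > k₂ implies G_1 ∩ ⋯ ∩ G_{k₂}")] -/
theorem inter_subset_Aev {G : Set Ω} (hG : ∀ j ∈ J, G ⊆ D j) {t : ℕ} (ht : 1 ≤ t) :
    G ∩ {ω | t ≤ (J.filter fun j => ω ∈ F j).card} ⊆ Aev F D J t := by
  classical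
  rintro ω ⟨hω, hcard⟩
  simp only [Set.mem_setOf_eq] at hcard
  have hD : ∀ j ∈ J, ω ∈ D j := fun j hj => hG j hj hω
  have key : ∀ n j, j ∈ J → ω ∈ F j → (failAbove F J j ω).card = n →
      ∀ t, 1 ≤ t → t ≤ n + 1 → ω ∈ Aev F D J t := by
    intro n
    induction n with
    | zero =>
      intro j hj hF hc t ht1 htn
      obtain rfl : t = 1 := by omega
      simp only [Aev, Set.mem_iUnion, exists_prop]
      exact ⟨j, hj, ⟨hF, hc, fun j' hj' _ _ => hD j' hj'⟩, hD j hj⟩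
    | succ n ih =>
      intro j hj hF hc t ht1 htn
      rcases Nat.lt_or_ge t (n + 2) with hlt | hge
      · have hne : (failAbove F J j ω).Nonempty := by rw [← Finset.card_pos, hc]; omega
        set m := (failAbove F J j ω).min' hne with hm
        have hm_mem := Finset.min'_mem _ hne
        rw [← hm] at hm_mem
        obtain ⟨hmJ, -, hmF⟩ := mem_failAbove_iff.1 hm_mem
        have hcm : (failAbove F J m ω).card = n := by
          rw [hm, failAbove_min' hne, Finset.card_erase_of_mem (hm ▸ hm_mem), hc]; rfl
        exact ih m hmJ hmF hcm t ht1 (by omega)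
      · obtain rfl : t = n + 2 := by omega
        simp only [Aev, Set.mem_iUnion, exists_prop]
        exact ⟨j, hj, ⟨hF, hc, fun j' hj' _ _ => hD j' hj'⟩, hD j hj⟩
  set FS := J.filter fun j => ω ∈ F j with hFS
  have hne : FS.Nonempty := by rw [← Finset.card_pos]; omega
  set m := FS.min' hne with hm
  have hm_mem := Finset.min'_mem _ hne
  rw [← hm] at hm_mem
  obtain ⟨hmJ, hmF⟩ := Finset.mem_filter.1 hm_mem
  have hfa : failAbove F J m ω = FS.erase m := by
    ext j''
    rw [mem_failAbove_iff, Finset.mem_erase, hFS, Finset.mem_filter]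
    constructor
    · rintro ⟨hJ'', hlt, hF''⟩; exact ⟨ne_of_gt hlt, hJ'', hF''⟩
    · rintro ⟨hne', hJ'', hF''⟩
      refine ⟨hJ'', lt_of_le_of_ne (hm ▸ Finset.min'_le _ _ (Finset.mem_filter.2 ⟨hJ'', hF''⟩)) (Ne.symm hne'), hF''⟩
  have hc : (failAbove F J m ω).card = FS.card - 1 := by
    rw [hfa, Finset.card_erase_of_mem (hm ▸ hm_mem)]
  exact key _ m hmJ hmF hc t ht (by omega)

open Classical in
/-- The event "at least `t` failure levels" is measurable. [folklore] -/
theorem measurableSet_card_le (hFm : ∀ j, MeasurableSet (F j)) (t : ℕ) :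
    MeasurableSet {ω : Ω | t ≤ (J.filter fun j => ω ∈ F j).card} := by
  have : {ω : Ω | t ≤ (J.filter fun j => ω ∈ F j).card} =
      ⋃ K ∈ J.powerset.filter (fun K => t ≤ K.card), ⋂ j ∈ J, {ω | ω ∈ F j ↔ j ∈ K} := by
    ext ω
    simp only [Set.mem_setOf_eq, Set.mem_iUnion, Set.mem_iInter, Finset.mem_filter, Finset.mem_powerset,
      exists_prop]
    constructor
    · intro h
      refine ⟨J.filter fun j => ω ∈ F j, ⟨Finset.filter_subset _ _, h⟩, fun j hj => ?_⟩
      simp [Finset.mem_filter, hj]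
    · rintro ⟨K, ⟨hKJ, hK⟩, hiff⟩
      have : J.filter (fun j => ω ∈ F j) = K := by
        ext j
        simp only [Finset.mem_filter]
        constructor
        · rintro ⟨hj, hF⟩; exact (hiff j hj).1 hF
        · intro hjK; exact ⟨hKJ hjK, (hiff j (hKJ hjK)).2 hjK⟩
      rwa [this]
  rw [this]
  refine Finset.measurableSet_biUnion _ fun K _ => Finset.measurableSet_biInter _ fun j _ => ?_
  by_cases hjK : j ∈ K
  · have : {ω : Ω | ω ∈ F j ↔ j ∈ K} = F j := by ext ω; simp [hjK]
    rw [this]; exact hFm j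
  · have : {ω : Ω | ω ∈ F j ↔ j ∈ K} = (F j)ᶜ := by ext ω; simp [hjK]
    rw [this]; exact (hFm j).compl

open Classical in
/-- **Counting the failure levels on an event**: `Σ_{j ∈ J} P(C ∩ F_j) = Σ_{t=1}^{|J|} P(C ∩ {t ≤ #failure levels})`
(both equal `E[#failures; C]`). [cite: KozmaNitzan2024, §4 p. 18 (the variable X)] -/
theorem sum_real_inter_eq (μ : Measure Ω) [IsFiniteMeasure μ] (hFm : ∀ j, MeasurableSet (F j)) {C : Set Ω}
    (hC : MeasurableSet C) :
    ∑ j ∈ J, μ.real (C ∩ F j) =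
      ∑ t ∈ Finset.Icc 1 J.card, μ.real (C ∩ {ω | t ≤ (J.filter fun j => ω ∈ F j).card}) := by
  have hcount := measurableSet_card_le (J := J) hFm
  have hL1 : ∀ j ∈ J, μ.real (C ∩ F j) = ∫ ω, (C ∩ F j).indicator (1 : Ω → ℝ) ω ∂μ :=
    fun j _ => (integral_indicator_one (hC.inter (hFm j))).symm
  have hR1 : ∀ t ∈ Finset.Icc 1 J.card, μ.real (C ∩ {ω | t ≤ (J.filter fun j => ω ∈ F j).card}) =
      ∫ ω, (C ∩ {ω | t ≤ (J.filter fun j => ω ∈ F j).card}).indicator (1 : Ω → ℝ) ω ∂μ :=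
    fun t _ => (integral_indicator_one (hC.inter (hcount t))).symm
  rw [Finset.sum_congr rfl hL1, Finset.sum_congr rfl hR1, ← integral_finsetSum, ← integral_finsetSum]
  · refine integral_congr_ae (Filter.Eventually.of_forall fun ω => ?_)
    show (∑ i ∈ J, (C ∩ F i).indicator 1 ω) =
      ∑ i ∈ Finset.Icc 1 J.card, (C ∩ {ω | i ≤ (J.filter fun j => ω ∈ F j).card}).indicator 1 ω
    by_cases hω : ω ∈ C
    · have e1 : ∀ j ∈ J, (C ∩ F j).indicator (1 : Ω → ℝ) ω = if ω ∈ F j then 1 else 0 := by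
        intro j _
        simp only [Set.indicator_apply, Set.mem_inter_iff, hω, true_and, Pi.one_apply]
      have e2 : ∀ t ∈ Finset.Icc 1 J.card,
          (C ∩ {ω | t ≤ (J.filter fun j => ω ∈ F j).card}).indicator (1 : Ω → ℝ) ω =
            if t ≤ (J.filter fun j => ω ∈ F j).card then 1 else 0 := by
        intro t _
        simp only [Set.indicator_apply, Set.mem_inter_iff, hω, true_and, Pi.one_apply, Set.mem_setOf_eq]
      rw [Finset.sum_congr rfl e1, Finset.sum_congr rfl e2, Finset.sum_boole, Finset.sum_boole]
      congr 1
      set k := (J.filter fun j => ω ∈ F j).card with hk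
      have hkJ : k ≤ J.card := Finset.card_filter_le _ _
      have : (Finset.Icc 1 J.card).filter (fun t => t ≤ k) = Finset.Icc 1 k := by
        ext t; simp only [Finset.mem_filter, Finset.mem_Icc]; omega
      rw [this, Nat.card_Icc]
      omega
    · have e1 : ∀ j ∈ J, (C ∩ F j).indicator (1 : Ω → ℝ) ω = 0 := by
        intro j _
        simp only [Set.indicator_apply, Set.mem_inter_iff, hω, false_and, if_false]
      have e2 : ∀ t ∈ Finset.Icc 1 J.card,
          (C ∩ {ω | t ≤ (J.filter fun j => ω ∈ F j).card}).indicator (1 : Ω → ℝ) ω = 0 := by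
        intro t _
        simp only [Set.indicator_apply, Set.mem_inter_iff, hω, false_and, if_false]
      rw [Finset.sum_congr rfl e1, Finset.sum_congr rfl e2, Finset.sum_const_zero, Finset.sum_const_zero]
  · intro t _
    exact (integrable_const (1 : ℝ)).indicator (hC.inter (hcount t))
  · intro j _
    exact (integrable_const (1 : ℝ)).indicator (hC.inter (hFm j))

open Classical in
/-- **Step II, abstract form** (KN p. 18): if `P(C) > 1 − δ`, the good event `C` forces `D` at every level of `J` off a
null set `Gᶜ`, the one-level estimate holds with `r = 1 − q`, and `q⁻¹ ≤ δ·|J|`, then at some level `j ∈ J` the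
failure event has `P(F_jᶜ) > 1 − 2δ`. [cite: KozmaNitzan2024, §4 p. 18 (Step II)] -/
theorem stepII_abstract (μ : Measure Ω) [IsProbabilityMeasure μ] {q δ : ℝ} (hq0 : 0 < q) (hq1 : q ≤ 1)
    (hFm : ∀ j, MeasurableSet (F j)) (hHm : ∀ t j, MeasurableSet (Hev F D J t j))
    (hone : ∀ t, ∀ j ∈ J, μ.real (Hev F D J t j ∩ D j) ≤ (1 - q) * μ.real (Hev F D J t j))
    {C G : Set Ω} (hC : MeasurableSet C) (hGnull : μ.real Gᶜ = 0) (hG : ∀ j ∈ J, C ∩ G ⊆ D j)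
    (hJ : 1 / q ≤ δ * (J.card : ℝ)) (hreach : 1 - δ < μ.real C) :
    ∃ j ∈ J, 1 - 2 * δ < μ.real (F j)ᶜ := by
  set r : ℝ := 1 - q with hr
  have hr0 : 0 ≤ r := by rw [hr]; linarith
  have hr1 : r < 1 := by rw [hr]; linarith
  have hJne : J.Nonempty := by
    rw [← Finset.card_pos]
    by_contra h0
    push Not at h0
    have : (J.card : ℝ) = 0 := by exact_mod_cast Nat.le_zero.1 h0
    rw [this, mul_zero] at hJ
    have : 0 < 1 / q := by positivity
    linarith
  -- tails
  have htail : ∀ t ∈ Finset.Icc 1 J.card, μ.real (C ∩ {ω | t ≤ (J.filter fun j => ω ∈ F j).card}) ≤ r ^ t := by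
    intro t ht
    have ht1 : 1 ≤ t := (Finset.mem_Icc.1 ht).1
    have hcov : C ∩ {ω | t ≤ (J.filter fun j => ω ∈ F j).card} ⊆ Aev F D J t ∪ Gᶜ := by
      intro ω hω
      by_cases hg : ω ∈ G
      · exact Or.inl (inter_subset_Aev hG ht1 ⟨⟨hω.1, hg⟩, hω.2⟩)
      · exact Or.inr hg
    calc _ ≤ μ.real (Aev F D J t ∪ Gᶜ) := measureReal_mono hcov
      _ ≤ μ.real (Aev F D J t) + μ.real Gᶜ := measureReal_union_le _ _
      _ ≤ r ^ t := by rw [hGnull, add_zero]; exact real_Aev_le μ hr0 hHm hone t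
  have hsum : ∑ j ∈ J, μ.real (C ∩ F j) ≤ 1 / q := by
    rw [sum_real_inter_eq μ hFm hC]
    calc _ ≤ ∑ t ∈ Finset.Icc 1 J.card, r ^ t := Finset.sum_le_sum htail
      _ ≤ ∑ t ∈ Finset.range (J.card + 1), r ^ t := by
          refine Finset.sum_le_sum_of_subset_of_nonneg (fun t ht => ?_) (fun t _ _ => pow_nonneg hr0 t)
          rw [Finset.mem_range]; rw [Finset.mem_Icc] at ht; omega
      _ = (r ^ (J.card + 1) - 1) / (r - 1) := geom_sum_eq hr1.ne _
      _ ≤ 1 / q := by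
          have e1 : (r ^ (J.card + 1) - 1) / (r - 1) = (1 - r ^ (J.card + 1)) / q := by
            have hq' : r - 1 = -q := by rw [hr]; ring
            rw [hq', div_neg, ← neg_div, neg_sub]
          rw [e1]
          exact div_le_div_of_nonneg_right (by linarith [pow_nonneg hr0 (J.card + 1)]) hq0.le
  obtain ⟨j, hj, hjle⟩ := Finset.exists_le_of_sum_le hJne
    (f := fun j => μ.real (C ∩ F j)) (g := fun _ => (1 / q) / J.card) (by
      rw [Finset.sum_const, nsmul_eq_mul, mul_div_cancel₀ _ (by exact_mod_cast hJne.card_pos.ne')]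
      exact hsum)
  refine ⟨j, hj, ?_⟩
  have hjδ : μ.real (C ∩ F j) ≤ δ := by
    refine hjle.trans ?_
    rw [div_le_iff₀ (by exact_mod_cast hJne.card_pos)]
    exact hJ
  have hsplit : μ.real C ≤ μ.real (C ∩ F j) + μ.real (F j)ᶜ := by
    rw [← measureReal_inter_add_sdiff (s := C) (hFm j)]
    exact add_le_add le_rfl (measureReal_mono fun ω hω => hω.2)
  linarith

end FailLevels

end SiteKN

end Summit.CriticalPhenomena.PercolationContinuityZ3.Theorems.Transplant

end
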